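import Mathlib
import Summits.NavierStokesRegularity.NavierStokesRegularity.Theorems.FilamentSkeletonRssSkeletonJ1RLineDefs
import Summits.NavierStokesRegularity.NavierStokesRegularity.Theorems.FilamentSkeletonRssSkeletonJ1RFarPinning
import Summits.NavierStokesRegularity.NavierStokesRegularity.Theorems.FilamentSkeletonRssSkeletonJ1RLiaFrameExists
import Summits.NavierStokesRegularity.NavierStokesRegularity.Theorems.FilamentSkeletonRssSkeletonJ1RLiaReference
import Summits.NavierStokesRegularity.NavierStokesRegularity.Theorems.FilamentSkeletonRssSkeletonJ1RLiaSliced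

/-!
# Crux `SkeletonJ1R` (stmt-NavierStokesRegularity-23610) · line `streamline_kantorovich_R` · RESHAPE 3 of stub L:
# `ReferenceInjectivityL` FOLLOWS FROM CORE PINNING (`CorePinningL`) — a REAL proof, via the landed far pinning

Lead `ns-fsr-lead-23610` g0, 2026-08-29.  MODEL rung, NEGATIVE side of the ladder: statements about a HYPOTHETICAL filament-type blow-up
skeleton; nothing here bears on Navier–Stokes regularity.

`referenceInjectivityL_of_core : CorePinningL → ReferenceInjectivityL` with `K ↦ 2K + 2`: at a parameter `τ` whose reference point is in the
closed switched region the core statement applies; otherwise (`2ℓ² < ‖x_j τ‖²`, say `τ > 0`) the last core parameter `τ₀ ∈ [0, τ)` exists (the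
waist `x_j 0` is in the core once `log Γ ≥ Rwd²/Rb²`), `(τ₀, τ]` is in the model region, and `far_pinning_pos` on `[τ₀′, τ]` for `τ₀′ ↓ τ₀` plus
continuity of `Y_j` give `‖Y_j τ‖ ≤ 2‖Y_j τ₀‖ + 2L ≤ (2K + 2)L`.  The far lemma's side conditions are discharged from the LIA structure:
tilt `≤ Rb/8 ≤ 1/2` (`SlicedReference`), and `|τ|·‖x_j″ τ‖ ≤ Rb/8 ≤ 1/7` (`IsLiaReference.abs_mul_curvature_le`: beyond `‖y‖² ≥ 3ℓ²` the
reference is straight, inside `‖x″‖ ≤ curvCeil` and `|τ| ≤ 2(√3ℓ + ‖waist‖)`, and the landed rate `curvCeil·(2(√3ℓ + ‖waist‖) + 1) ≤ Rb/8`).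
-/

set_option linter.dupNamespace false -- `NavierStokesRegularity.NavierStokesRegularity` path/namespace repetition is the tree convention
set_option linter.style.longLine false -- statement lines follow the registered skeleton's layout

namespace Summit.NavierStokesRegularity.NavierStokesRegularity.Theorems.SkeletonJ1RFrame

open Set Function Filter Real Topology
open scoped InnerProductSpace

variable {N : ℕ} {Γ Rb ρ lam α θd : ℝ} {γ : Fin N → ℝ} {p t : Fin N → EuclideanSpace ℝ (Fin 3)} {s₀ : Fin N → ℝ}
  {x Y : Fin N → ℝ → EuclideanSpace ℝ (Fin 3)} {M : EuclideanSpace ℝ (Fin 3) → EuclideanSpace ℝ (Fin 3)}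

/-! ## §1 Parameter vs. position on a near-straight curve; `|τ|·‖x″‖` for the LIA reference -/

/-- A `C¹` curve with GLOBAL tilt `≤ θ ≤ 1/2` against a unit direction satisfies `|τ| ≤ 2(‖x τ‖ + ‖x 0‖)`. [folklore] -/
theorem abs_param_le_of_nearStraight {x : ℝ → EuclideanSpace ℝ (Fin 3)} (hx : ContDiff ℝ 1 x) {e : EuclideanSpace ℝ (Fin 3)}
    (he : ‖e‖ = 1) {θ : ℝ} (hθ : θ ≤ 1 / 2) (htilt : ∀ σ, ‖deriv x σ - e‖ ≤ θ) (τ : ℝ) : |τ| ≤ 2 * (‖x τ‖ + ‖x 0‖) := by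
  have h := norm_sub_line_le_of_nearStraight hx htilt τ
  have hτe : ‖τ • e‖ = |τ| := by rw [norm_smul, he, mul_one, Real.norm_eq_abs]
  have : |τ| ≤ ‖x τ - (x 0 + τ • e)‖ + ‖x τ‖ + ‖x 0‖ := by
    rw [← hτe]
    calc ‖τ • e‖ = ‖(x τ - x 0) - (x τ - (x 0 + τ • e))‖ := by congr 1; abel
      _ ≤ ‖x τ - x 0‖ + ‖x τ - (x 0 + τ • e)‖ := norm_sub_le _ _
      _ ≤ ‖x τ‖ + ‖x 0‖ + ‖x τ - (x 0 + τ • e)‖ := by gcongr; exact norm_sub_le _ _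
      _ = _ := by ring
  have hθτ : θ * |τ| ≤ |τ| / 2 := by nlinarith [abs_nonneg τ]
  linarith

/-- **`|τ|·‖x_j″ τ‖ ≤ Rb/8` for the LIA reference** under the rate hypotheses of `IsLiaReference.tilt_le`: beyond `‖y‖² ≥ 3ℓ²` the reference is
straight; inside, `‖x″‖ ≤ curvCeil`, `|τ| ≤ 2(√3|ℓ| + ‖waist‖)`, and `curvCeil·(2(√3|ℓ| + ‖waist‖) + 1) ≤ Rb/8`. [folklore] -/
theorem IsLiaReference.abs_mul_curvature_le (hx : IsLiaReference Γ Rb p t γ α s₀ x) (ht : ∀ k, ‖t k‖ = 1) (hθd : 0 < θd) (hθd1 : θd ≤ 1)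
    (hgp : ∀ j k, j ≠ k → |inner ℝ (t j) (t k)| ≤ 1 - θd) (hρ : 0 < ρ)
    (hsep : ∀ j k, j ≠ k → ∀ a b : ℝ, ρ ≤ ‖(p j + a • t j) - (p k + b • t k)‖) (hΓ : 0 < Γ) (hℓ : Rb * Real.sqrt (Γ * Real.log Γ) ≠ 0)
    (j : Fin N) {θ₁ : ℝ} (hRbθ : Rb / 8 < θ₁) (hθ₁h : θ₁ ≤ 1 / 2)
    (hθ₁A : ∀ k, k ≠ j → θ₁ ≤ min (Real.sqrt θd / 4) (θd * ρ / (16 * (‖(p j + s₀ j • t j) - (p k + s₀ k • t k)‖ + ρ))))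
    (hrate : curvCeil Γ Rb ρ γ α j * (2 * (Real.sqrt 3 * |Rb * Real.sqrt (Γ * Real.log Γ)| + ‖waistPt Γ p t s₀ j‖) + 1) ≤ Rb / 8) :
    ∀ τ, |τ| * ‖iteratedDeriv 2 (x j) τ‖ ≤ Rb / 8 := by
  have htilt := hx.tilt_le ht hθd hθd1 hgp hρ hsep hΓ hℓ j hRbθ hθ₁h hθ₁A hrate
  obtain ⟨hC2, hunit, h0, -, -⟩ := hx j
  have hRb0 : 0 ≤ Rb / 8 := (norm_nonneg _).trans (htilt 0)
  have hθ₁0 : 0 ≤ θ₁ := by linarith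
  have hκ0 : 0 ≤ curvCeil Γ Rb ρ γ α j := curvCeil_nonneg hρ.le j
  intro τ
  by_cases hout : 3 * (Rb * Real.sqrt (Γ * Real.log Γ)) ^ 2 ≤ ‖x j τ‖ ^ 2
  · rw [hx.iteratedDeriv_two_eq_zero hℓ j hout, norm_zero, mul_zero]; exact hRb0
  · push Not at hout
    -- inside: curvature ≤ curvCeil and |τ| ≤ 2(√3|ℓ| + ‖waist‖)
    have hκ : ‖iteratedDeriv 2 (x j) τ‖ ≤ curvCeil Γ Rb ρ γ α j := by
      rcases le_total 0 τ with hτ | hτ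
      · exact hx.curvature_le_of_tiltOn ht hθd hθd1 hgp hρ hsep hΓ hℓ j hθ₁0 hθ₁A (T := τ)
          (fun σ _ => (htilt σ).trans hRbθ.le) τ ⟨hτ, le_rfl⟩
      · exact hx.curvature_le_of_tiltOn_neg ht hθd hθd1 hgp hρ hsep hΓ hℓ j hθ₁0 hθ₁A (T := -τ)
          (fun σ _ => (htilt σ).trans hRbθ.le) τ ⟨by linarith, hτ⟩
    have hin : ‖x j τ‖ ≤ Real.sqrt 3 * |Rb * Real.sqrt (Γ * Real.log Γ)| := by
      have h1 : ‖x j τ‖ = Real.sqrt (‖x j τ‖ ^ 2) := (Real.sqrt_sq (norm_nonneg _)).symm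
      have h2 : Real.sqrt 3 * |Rb * Real.sqrt (Γ * Real.log Γ)| = Real.sqrt (3 * (Rb * Real.sqrt (Γ * Real.log Γ)) ^ 2) := by
        rw [Real.sqrt_mul (show (0:ℝ) ≤ 3 by norm_num) ((Rb * Real.sqrt (Γ * Real.log Γ)) ^ 2), Real.sqrt_sq_eq_abs]
      rw [h1, h2]; exact Real.sqrt_le_sqrt hout.le
    have hτabs : |τ| ≤ 2 * (Real.sqrt 3 * |Rb * Real.sqrt (Γ * Real.log Γ)| + ‖waistPt Γ p t s₀ j‖) := by
      have h := abs_param_le_of_nearStraight (hC2.of_le (by norm_num)) (ht j) hθ₁h (fun σ => (htilt σ).trans hRbθ.le) τ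
      rw [h0] at h
      linarith
    calc |τ| * ‖iteratedDeriv 2 (x j) τ‖
        ≤ (2 * (Real.sqrt 3 * |Rb * Real.sqrt (Γ * Real.log Γ)| + ‖waistPt Γ p t s₀ j‖)) * curvCeil Γ Rb ρ γ α j := by
          gcongr
      _ ≤ curvCeil Γ Rb ρ γ α j * (2 * (Real.sqrt 3 * |Rb * Real.sqrt (Γ * Real.log Γ)| + ‖waistPt Γ p t s₀ j‖) + 1) := by
          nlinarith
      _ ≤ Rb / 8 := hrate

/-! ## §2 From the last core parameter into the model region -/

/-- **Far from core, forward.**  Under the hypotheses of `far_pinning_pos` holding for all parameters (`|s|‖x″‖ ≤ λ/7`, derivative bound `L`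
everywhere), if the waist parameter `0` is a core parameter (`‖x_j 0‖² ≤ 2ℓ²`), `τ > 0` is a model-region parameter, and `‖Y_j s‖ ≤ C` at every
core parameter `s ∈ [0, τ]`, then `‖Y_j τ‖ ≤ 2C + 2L/λ` (last core parameter `τ₀ = sup`, `far_pinning_pos` on `[τ₀′, τ]`, `τ₀′ ↓ τ₀`, continuity).
[folklore] -/
theorem far_of_core_pos (hM : SlicedModel Γ ρ lam t x M) (hlam : 0 < lam) (hρΓ : 0 < ρ * Real.sqrt Γ)
    (hℓ : Rb * Real.sqrt (Γ * Real.log Γ) ≠ 0) (j : Fin N) (hxj : ContDiff ℝ 2 (x j)) (hunit : ∀ s, ‖deriv (x j) s‖ = 1) (ht : ‖t j‖ = 1)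
    (htilt : ∀ s, ‖deriv (x j) s - t j‖ ≤ 1 / 2) (hYj : ContDiff ℝ 1 (Y j)) (hperp : ∀ s, ⟪Y j s, deriv (x j) s⟫_ℝ = 0)
    (hκ : ∀ s, |s| * ‖iteratedDeriv 2 (x j) s‖ ≤ lam / 7) {L C τ : ℝ}
    (hD : ∀ s, ∃ D : EuclideanSpace ℝ (Fin 3),
      HasDerivAt (fun r : ℝ => swDefect Γ Rb γ α M (fun k σ => x k σ + r • Y k σ) j s) D 0 ∧ ‖D‖ ≤ L)
    (h0 : ‖x j 0‖ ^ 2 ≤ 2 * (Rb * Real.sqrt (Γ * Real.log Γ)) ^ 2) (hτ : 0 < τ)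
    (hfar : 2 * (Rb * Real.sqrt (Γ * Real.log Γ)) ^ 2 < ‖x j τ‖ ^ 2)
    (hC : ∀ s ∈ Icc 0 τ, ‖x j s‖ ^ 2 ≤ 2 * (Rb * Real.sqrt (Γ * Real.log Γ)) ^ 2 → ‖Y j s‖ ≤ C) :
    ‖Y j τ‖ ≤ 2 * C + 2 * L / lam := by
  set ℓ2 := 2 * (Rb * Real.sqrt (Γ * Real.log Γ)) ^ 2 with hℓ2
  set S : Set ℝ := {s | s ∈ Icc 0 τ ∧ ‖x j s‖ ^ 2 ≤ ℓ2} with hS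
  have hxc : Continuous (x j) := hxj.continuous
  have hSclosed : IsClosed S := by
    have : S = Icc 0 τ ∩ {s | ‖x j s‖ ^ 2 ≤ ℓ2} := by ext s; simp [hS]
    rw [this]
    exact isClosed_Icc.inter (isClosed_le (by fun_prop) continuous_const)
  have hS0 : (0:ℝ) ∈ S := ⟨⟨le_rfl, hτ.le⟩, h0⟩
  have hSbdd : BddAbove S := ⟨τ, fun s hs => hs.1.2⟩
  set τ₀ := sSup S with hτ₀
  have hτ₀S : τ₀ ∈ S := hSclosed.csSup_mem ⟨0, hS0⟩ hSbdd
  have hτ₀0 : 0 ≤ τ₀ := hτ₀S.1.1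
  have hτ₀τ : τ₀ < τ := by
    rcases hτ₀S.1.2.lt_or_eq with h | h
    · exact h
    · exact absurd hτ₀S.2 (by rw [h]; exact not_le.2 hfar)
  have hfarI : ∀ s, τ₀ < s → s ≤ τ → ℓ2 < ‖x j s‖ ^ 2 := by
    intro s hs hsτ
    by_contra hle
    have : s ∈ S := ⟨⟨hτ₀0.trans hs.le, hsτ⟩, not_lt.1 hle⟩
    exact absurd (le_csSup hSbdd this) (not_le.2 hs)
  have hYτ₀ : ‖Y j τ₀‖ ≤ C := hC τ₀ hτ₀S.1 hτ₀S.2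
  -- ε-argument: far pinning on [τ₀', τ] with τ₀' ↓ τ₀
  refine le_of_forall_pos_lt_add fun ε hε => ?_
  have hYc : ContinuousAt (fun s => ‖Y j s‖) τ₀ := (hYj.continuous.norm).continuousAt
  obtain ⟨δ, hδ, hδY⟩ := Metric.continuousAt_iff.1 hYc (ε / 2) (by positivity)
  set τ₁ := min τ (τ₀ + δ / 2) with hτ₁
  have hτ₁τ₀ : τ₀ < τ₁ := lt_min hτ₀τ (by linarith)
  have hτ₁τ : τ₁ ≤ τ := min_le_left _ _
  have hτ₁pos : 0 < τ₁ := lt_of_le_of_lt hτ₀0 hτ₁τ₀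
  have hnear : ‖Y j τ₁‖ < ‖Y j τ₀‖ + ε / 2 := by
    have hd : dist τ₁ τ₀ < δ := by
      rw [Real.dist_eq, abs_of_pos (by linarith)]
      have := min_le_right τ (τ₀ + δ / 2); linarith
    have := hδY hd
    rw [Real.dist_eq] at this
    linarith [(abs_lt.1 this).2]
  have hpin := far_pinning_pos (γ := γ) (α := α) hM hlam hρΓ hℓ j hxj hunit ht htilt hYj hperp hτ₁pos hτ₁τ
    (fun s hs => hfarI s (lt_of_lt_of_le hτ₁τ₀ hs.1) hs.2) (fun s _ => hκ s) (fun s _ => hD s) τ ⟨hτ₁τ, le_rfl⟩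
  have hL : 0 ≤ 2 * L / lam := by
    obtain ⟨D, -, hDL⟩ := hD 0
    have : 0 ≤ L := (norm_nonneg D).trans hDL
    positivity
  linarith

/-- **Far from core, backward** (mirror of `far_of_core_pos` for `τ < 0`, last core parameter `τ₀ = inf`, `far_pinning_neg`). [folklore] -/
theorem far_of_core_neg (hM : SlicedModel Γ ρ lam t x M) (hlam : 0 < lam) (hρΓ : 0 < ρ * Real.sqrt Γ)
    (hℓ : Rb * Real.sqrt (Γ * Real.log Γ) ≠ 0) (j : Fin N) (hxj : ContDiff ℝ 2 (x j)) (hunit : ∀ s, ‖deriv (x j) s‖ = 1) (ht : ‖t j‖ = 1)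
    (htilt : ∀ s, ‖deriv (x j) s - t j‖ ≤ 1 / 2) (hYj : ContDiff ℝ 1 (Y j)) (hperp : ∀ s, ⟪Y j s, deriv (x j) s⟫_ℝ = 0)
    (hκ : ∀ s, |s| * ‖iteratedDeriv 2 (x j) s‖ ≤ lam / 7) {L C τ : ℝ}
    (hD : ∀ s, ∃ D : EuclideanSpace ℝ (Fin 3),
      HasDerivAt (fun r : ℝ => swDefect Γ Rb γ α M (fun k σ => x k σ + r • Y k σ) j s) D 0 ∧ ‖D‖ ≤ L)
    (h0 : ‖x j 0‖ ^ 2 ≤ 2 * (Rb * Real.sqrt (Γ * Real.log Γ)) ^ 2) (hτ : τ < 0)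
    (hfar : 2 * (Rb * Real.sqrt (Γ * Real.log Γ)) ^ 2 < ‖x j τ‖ ^ 2)
    (hC : ∀ s ∈ Icc τ 0, ‖x j s‖ ^ 2 ≤ 2 * (Rb * Real.sqrt (Γ * Real.log Γ)) ^ 2 → ‖Y j s‖ ≤ C) :
    ‖Y j τ‖ ≤ 2 * C + 2 * L / lam := by
  set ℓ2 := 2 * (Rb * Real.sqrt (Γ * Real.log Γ)) ^ 2 with hℓ2
  set S : Set ℝ := {s | s ∈ Icc τ 0 ∧ ‖x j s‖ ^ 2 ≤ ℓ2} with hS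
  have hxc : Continuous (x j) := hxj.continuous
  have hSclosed : IsClosed S := by
    have : S = Icc τ 0 ∩ {s | ‖x j s‖ ^ 2 ≤ ℓ2} := by ext s; simp [hS]
    rw [this]
    exact isClosed_Icc.inter (isClosed_le (by fun_prop) continuous_const)
  have hS0 : (0:ℝ) ∈ S := ⟨⟨hτ.le, le_rfl⟩, h0⟩
  have hSbdd : BddBelow S := ⟨τ, fun s hs => hs.1.1⟩
  set τ₀ := sInf S with hτ₀
  have hτ₀S : τ₀ ∈ S := hSclosed.csInf_mem ⟨0, hS0⟩ hSbdd
  have hτ₀0 : τ₀ ≤ 0 := hτ₀S.1.2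
  have hτ₀τ : τ < τ₀ := by
    rcases hτ₀S.1.1.lt_or_eq with h | h
    · exact h
    · exact absurd hτ₀S.2 (by rw [← h]; exact not_le.2 hfar)
  have hfarI : ∀ s, τ ≤ s → s < τ₀ → ℓ2 < ‖x j s‖ ^ 2 := by
    intro s hsτ hs
    by_contra hle
    have : s ∈ S := ⟨⟨hsτ, hs.le.trans hτ₀0⟩, not_lt.1 hle⟩
    exact absurd (csInf_le hSbdd this) (not_le.2 hs)
  have hYτ₀ : ‖Y j τ₀‖ ≤ C := hC τ₀ hτ₀S.1 hτ₀S.2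
  refine le_of_forall_pos_lt_add fun ε hε => ?_
  have hYc : ContinuousAt (fun s => ‖Y j s‖) τ₀ := (hYj.continuous.norm).continuousAt
  obtain ⟨δ, hδ, hδY⟩ := Metric.continuousAt_iff.1 hYc (ε / 2) (by positivity)
  set τ₁ := max τ (τ₀ - δ / 2) with hτ₁
  have hτ₁τ₀ : τ₁ < τ₀ := max_lt hτ₀τ (by linarith)
  have hτ₁τ : τ ≤ τ₁ := le_max_left _ _
  have hτ₁neg : τ₁ < 0 := lt_of_lt_of_le hτ₁τ₀ hτ₀0
  have hnear : ‖Y j τ₁‖ < ‖Y j τ₀‖ + ε / 2 := by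
    have hd : dist τ₁ τ₀ < δ := by
      rw [Real.dist_eq, abs_of_neg (by linarith)]
      have := le_max_right τ (τ₀ - δ / 2); linarith
    have := hδY hd
    rw [Real.dist_eq] at this
    linarith [(abs_lt.1 this).2]
  have hpin := far_pinning_neg (γ := γ) (α := α) hM hlam hρΓ hℓ j hxj hunit ht htilt hYj hperp hτ₁neg hτ₁τ
    (fun s hs => hfarI s hs.1 (lt_of_le_of_lt hs.2 hτ₁τ₀)) (fun s _ => hκ s) (fun s _ => hD s) τ ⟨le_rfl, hτ₁τ⟩
  have hL : 0 ≤ 2 * L / lam := by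
    obtain ⟨D, -, hDL⟩ := hD 0
    have : 0 ≤ L := (norm_nonneg D).trans hDL
    positivity
  linarith

/-! ## §3 Reference injectivity from core pinning -/

/-- **RESHAPE 3 of stub L: `CorePinningL → ReferenceInjectivityL`** (`Rb₁ ↦ min Rb₁ (rates)`, `Γ₂ ↦ max Γ₂ (rates, e^{Rwd²/Rb²})`, `K ↦ 2K + 2`).
(real proof; the registered stub of the line is now `stub_corePinningL`) -/
theorem referenceInjectivityL_of_core (hcore : CorePinningL) : ReferenceInjectivityL := by
  intro N δd ρd Λd Rwd θd mw p t γ α s₀ hN hδ hρ hRw hθ hmw hSD hGP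
  obtain ⟨Rb₁, hRb₁, hcoreRb⟩ := hcore N δd ρd Λd Rwd θd mw p t γ α s₀ hN hδ hρ hRw hθ hmw hSD hGP
  obtain ⟨ht, hsep, -, hparams, hwaist, -⟩ := hSD
  have hγ : ∀ j, γ j ≠ 0 := fun j => by
    have := (hparams.2.2 j).1; intro h0; rw [h0, abs_zero] at this; linarith
  -- general position with θd' = min θd 1 ∈ (0, 1]
  set θd' := min θd 1 with hθd'
  have hθd'0 : 0 < θd' := lt_min hθ one_pos
  have hθd'1 : θd' ≤ 1 := min_le_right _ _
  have hGP' : ∀ j k, j ≠ k → |inner ℝ (t j) (t k)| ≤ 1 - θd' := fun j k hjk =>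
    (hGP j k hjk).trans (by linarith [min_le_left θd 1])
  -- tilt budget and rates
  obtain ⟨θ₁, hθ₁0, hθ₁h, hθ₁A⟩ := tiltBudget_exists θd' ρd (fun j => p j + s₀ j • t j) hθd'0 hρ
  obtain ⟨RbR, hRbR0, hrates⟩ := curvCeil_rates_all hN ρd p t s₀ γ α hρ hγ
  refine ⟨min Rb₁ (min 1 (min RbR (4 * θ₁))), lt_min hRb₁ (lt_min one_pos (lt_min hRbR0 (by positivity))), fun Rb hRb hRble => ?_⟩
  have hRbRb₁ : Rb ≤ Rb₁ := hRble.trans (min_le_left _ _)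
  have hRb1 : Rb ≤ 1 := hRble.trans ((min_le_right _ _).trans (min_le_left _ _))
  have hRbR : Rb ≤ RbR := hRble.trans ((min_le_right _ _).trans ((min_le_right _ _).trans (min_le_left _ _)))
  have hRbθ : Rb / 8 < θ₁ := by
    have : Rb ≤ 4 * θ₁ := hRble.trans ((min_le_right _ _).trans ((min_le_right _ _).trans (min_le_right _ _))); linarith
  obtain ⟨Γc, Kc, hKc, hcoreΓ⟩ := hcoreRb Rb hRb hRbRb₁
  obtain ⟨Γ₁, hΓ₁3, hΓrates⟩ := hrates Rb hRb hRbR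
  refine ⟨max Γc (max Γ₁ (Real.exp (Rwd ^ 2 / Rb ^ 2))), 2 * Kc + 2, by positivity, fun Γ hΓ x M hx hframe Y B L hY hperp hB hD j τ => ?_⟩
  have hΓc : Γc ≤ Γ := (le_max_left _ _).trans hΓ
  have hΓ1 : Γ₁ ≤ Γ := ((le_max_left _ _).trans (le_max_right _ _)).trans hΓ
  have hΓw : Real.exp (Rwd ^ 2 / Rb ^ 2) ≤ Γ := ((le_max_right _ _).trans (le_max_right _ _)).trans hΓ
  have hΓ0 : 0 < Γ := by linarith
  obtain ⟨hrate, -, hℓ⟩ := hΓrates Γ hΓ1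
  have hcoreY := hcoreΓ Γ hΓc x M hx hframe Y B L hY hperp hB hD
  have hL0 : 0 ≤ L := by obtain ⟨D, -, hDL⟩ := hD j τ; exact (norm_nonneg D).trans hDL
  by_cases hcoreτ : ‖x j τ‖ ^ 2 ≤ 2 * (Rb * Real.sqrt (Γ * Real.log Γ)) ^ 2
  · have := hcoreY j τ hcoreτ
    nlinarith
  · push Not at hcoreτ
    -- side conditions of the far lemmas
    obtain ⟨⟨hbase, htiltR, -, -⟩, hM⟩ := hframe
    have hxj : ContDiff ℝ 2 (x j) := (hx j).1
    have hunit : ∀ s, ‖deriv (x j) s‖ = 1 := (hx j).2.1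
    have htilt : ∀ s, ‖deriv (x j) s - t j‖ ≤ 1 / 2 := fun s => (htiltR j s).trans (by linarith)
    have hYj : ContDiff ℝ 1 (Y j) := (hY j).of_le (by norm_num)
    have hρΓ : 0 < ρd * Real.sqrt Γ := by have := Real.sqrt_pos.2 hΓ0; positivity
    have hκ : ∀ s, |s| * ‖iteratedDeriv 2 (x j) s‖ ≤ (1:ℝ) / 7 := fun s =>
      (hx.abs_mul_curvature_le ht hθd'0 hθd'1 hGP' hρ hsep hΓ0 hℓ j hRbθ hθ₁h (fun k hk => hθ₁A j k) (hrate j) s).trans (by linarith)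
    -- the waist is a core point once log Γ ≥ Rwd²/Rb²
    have h0 : ‖x j 0‖ ^ 2 ≤ 2 * (Rb * Real.sqrt (Γ * Real.log Γ)) ^ 2 := by
      rw [(hx j).2.2.1]
      unfold waistPt
      have hlog : Rwd ^ 2 / Rb ^ 2 ≤ Real.log Γ := by
        have := Real.log_le_log (Real.exp_pos _) hΓw
        rwa [Real.log_exp] at this
      have hlog0 : 0 ≤ Real.log Γ := le_trans (by positivity) hlog
      have hq : ‖p j + s₀ j • t j‖ ≤ Rwd := hwaist j
      have hq2 : ‖p j + s₀ j • t j‖ ^ 2 ≤ Rb ^ 2 * Real.log Γ := by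
        have h1 : ‖p j + s₀ j • t j‖ ^ 2 ≤ Rwd ^ 2 := pow_le_pow_left₀ (norm_nonneg _) hq 2
        have h2 : Rwd ^ 2 ≤ Rb ^ 2 * Real.log Γ := by
          rw [div_le_iff₀ (by positivity)] at hlog; linarith
        linarith
      rw [norm_smul, Real.norm_of_nonneg (Real.sqrt_nonneg _)]
      simp only [mul_pow, Real.sq_sqrt hΓ0.le, Real.sq_sqrt (by positivity : 0 ≤ Γ * Real.log Γ)]
      nlinarith [mul_le_mul_of_nonneg_left hq2 hΓ0.le, hΓ0.le, hlog0]
    have hDj : ∀ s, ∃ D : EuclideanSpace ℝ (Fin 3),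
        HasDerivAt (fun r : ℝ => swDefect Γ Rb γ α M (fun k σ => x k σ + r • Y k σ) j s) D 0 ∧ ‖D‖ ≤ L := fun s => hD j s
    have hτ0 : τ ≠ 0 := by rintro rfl; exact absurd h0 (not_le.2 hcoreτ)
    rcases hτ0.lt_or_gt with hneg | hpos
    · have h := far_of_core_neg (C := Kc * L) hM one_pos hρΓ hℓ j hxj hunit (ht j) htilt hYj (hperp j) hκ hDj h0 hneg hcoreτ
        (fun s _ hs => hcoreY j s hs)
      linarith
    · have h := far_of_core_pos (C := Kc * L) hM one_pos hρΓ hℓ j hxj hunit (ht j) htilt hYj (hperp j) hκ hDj h0 hpos hcoreτ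
        (fun s _ hs => hcoreY j s hs)
      linarith

end Summit.NavierStokesRegularity.NavierStokesRegularity.Theorems.SkeletonJ1RFrame
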